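import Literature.Geometry.Kaehler.CyclotomicThirteenHodgeConjecture
import Literature.NumberTheory.Automorphic.Arthur2013.Leaves.TorusCyclotomic
import Mathlib.RingTheory.Polynomial.Cyclotomic.Expand
import HarnessLib

/-!
# `Φ₂₆(X) = Φ₁₃(−X)`: complex tori with an endomorphism of characteristic polynomial `Φ₂₆` have `Hdg = Div` on all powers; abelian varieties with
# complex multiplication by `ℚ(ζ₂₆) = ℚ(ζ₁₃)` satisfy the Hodge conjecture with all their powers

Layer `Literature/Geometry/Kaehler`, namespace `Literature.Geometry.Kaehler.ComplexTorus`; lane `lit-hodgefound` (Track 2 foundations library), prover seat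
`lit-hodgefound-p10`, generation 33, row «A2-26(ht)» (self-proposed 2026-08-28).  Theorems only; no `def`, no instance, no named fact (net Literature debt 0).
Sequel of `CyclotomicThirteenHodgeConjecture` in the manner of `ComplexTorusCyclotomicCharpolyThirty` (`Φ₃₀(X) = Φ₁₅(−X)`): an endomorphism `u` with
`P_u = Φ₂₆` has `P_{−u} = Φ₁₃` (minimal-polynomial argument over `ℚ`), and `ℚ(ζ₂₆) = ℚ(ζ₁₃)` (tree `isCyclotomicExtension_of_two_mul_of_odd`).  With this
file every `d` with `φ(d) ≤ 12` EXCEPT `d ∈ {21, 28, 36, 42}` — where degenerate primitive types and exceptional Hodge classes genuinely occur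
(`Pohlmann1968/DegenerateCMTypeCyclotomic21`) — is covered by the generation's files.

* §1 `cyclotomic_thirteen_int`, `cyclotomic_twentySix_int` (`Φ₂₆ = X¹² − X¹¹ + ⋯ − X + 1`), `cyclotomic_thirteen_comp_neg_X`,
  **`charpoly_neg_eq_cyclotomic_thirteen_of_charpoly_eq_cyclotomic_twentySix`**.
* §2 **`divisorClasses_powPeriod_eq_hodgeClasses_of_charpoly_eq_cyclotomic_twentySix`** (every complex torus with `P_u = Φ₂₆`, all powers).
* §3 **`hodgeConjectureFor_pow_twentySix`** (every abelian variety with complex multiplication by a `{26}`-th cyclotomic extension of `ℚ`, any CM type,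
  all powers), `isNondegenerate_iff_isPrimitive_twentySix`.

## References

* [Shimura1998] G. Shimura (1998), §8.4 Example (1) (`p = 13`).
* [Washington1997] L. C. Washington, *Introduction to Cyclotomic Fields*, 2nd ed. (1997), Ch. 2 (`Φ_{2n}(X) = Φ_n(−X)`, `n` odd; `ℚ(ζ_{2n}) = ℚ(ζ_n)`).
* [BirkenhakeLange2004] Ch. Birkenhake, H. Lange, *Complex Abelian Varieties*, 2nd ed. (2004), §13.3.
* [Gordon1999HodgeAVSurvey] B. B. Gordon (1999), Thm. 6.4, 7.5, §9.3.
-/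

noncomputable section

open scoped Classical nonZeroDivisors NumberField Manifold ContDiff MatrixGroups
open NumberField Module Polynomial CategoryTheory CategoryTheory.Limits

namespace Literature.Geometry.Kaehler

namespace ComplexTorus

-- `open scoped`: the tree's action of `Aut(ℂ)` on `Hom(K, ℂ)` by composition (`ringEquivCompAction`) is a scoped instance
open scoped Literature.NumberTheory.ComplexMultiplication
open Literature.AlgebraicGeometry.Motives (CMType AbelianVariety)
open Literature.AlgebraicGeometry.HodgeTheory (HodgeConjectureFor complexBetti)
open Literature.NumberTheory.ComplexMultiplication (IsPrimitive)
open Literature.AlgebraicGeometry.Pohlmann1968 (IsNondegenerate)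
open Literature.AlgebraicGeometry.ComplexMultiplication (IsCMTypeRealisation)
open Literature.NumberTheory.Automorphic.Arthur2013.Leaves.TECR.TorusDict (isCyclotomicExtension_of_two_mul_of_odd)

/-! ### §1 `Φ₁₃`, `Φ₂₆` and `P_{−A}` -/

/-- **`Φ₁₃ = X¹² + X¹¹ + ⋯ + X + 1`.** [cite: Washington1997, Ch. 2] -/
theorem cyclotomic_thirteen_int : cyclotomic 13 ℤ = X ^ 12 + X ^ 11 + X ^ 10 + X ^ 9 + X ^ 8 + X ^ 7 + X ^ 6 + X ^ 5 + X ^ 4 + X ^ 3 + X ^ 2 + X + 1 := by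
  haveI : Fact (Nat.Prime 13) := ⟨by norm_num⟩
  rw [cyclotomic_prime ℤ 13]
  simp [Finset.sum_range_succ]
  ring

/-- **`Φ₂₆ = X¹² − X¹¹ + ⋯ − X + 1`** (from `Φ₁₃(X²) = Φ₂₆ Φ₁₃`). [cite: Washington1997, Ch. 2] -/
theorem cyclotomic_twentySix_int : cyclotomic 26 ℤ = X ^ 12 - X ^ 11 + X ^ 10 - X ^ 9 + X ^ 8 - X ^ 7 + X ^ 6 - X ^ 5 + X ^ 4 - X ^ 3 + X ^ 2 - X + 1 := by
  have h := cyclotomic_expand_eq_cyclotomic_mul Nat.prime_two (by norm_num : ¬ 2 ∣ 13) ℤ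
  rw [show (13 * 2 : ℕ) = 26 by norm_num, cyclotomic_thirteen_int] at h
  have hexp : expand ℤ 2 (X ^ 12 + X ^ 11 + X ^ 10 + X ^ 9 + X ^ 8 + X ^ 7 + X ^ 6 + X ^ 5 + X ^ 4 + X ^ 3 + X ^ 2 + X + 1 : ℤ[X]) = X ^ 24 + X ^ 22 + X ^ 20 + X ^ 18 + X ^ 16 + X ^ 14 + X ^ 12 + X ^ 10 + X ^ 8 + X ^ 6 + X ^ 4 + X ^ 2 + 1 := by
    simp [expand_X]
    ring
  rw [hexp] at h
  have hne : (X ^ 12 + X ^ 11 + X ^ 10 + X ^ 9 + X ^ 8 + X ^ 7 + X ^ 6 + X ^ 5 + X ^ 4 + X ^ 3 + X ^ 2 + X + 1 : ℤ[X]) ≠ 0 := by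
    rw [← cyclotomic_thirteen_int]; exact cyclotomic_ne_zero 13 ℤ
  apply mul_right_cancel₀ hne
  rw [← h]
  ring

/-- **`Φ₁₃(−X) = Φ₂₆`.** [cite: Washington1997, Ch. 2] -/
theorem cyclotomic_thirteen_comp_neg_X : (cyclotomic 13 ℤ).comp (-X) = cyclotomic 26 ℤ := by
  rw [cyclotomic_thirteen_int, cyclotomic_twentySix_int]
  simp [add_comp]
  ring

section MatrixAlgebra

variable {ι : Type} [Fintype ι] [DecidableEq ι]

/-- The minimal-polynomial argument (`Φ_n(−A) = Φ_m(A) = 0`, `Φ_n` irreducible, degrees). [cite: Washington1997, Ch. 2] [cite: BirkenhakeLange2004, §13.3 Cor. 13.3.4] -/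
private theorem charpoly_neg_eq_cyclotomic_of_comp_neg_X₅₁ {m n : ℕ} (hm : 0 < m) (hn : 0 < n)
    (hcomp : (cyclotomic n ℤ).comp (-X) = cyclotomic m ℤ) (htot : Nat.totient n = Nat.totient m) {A : Matrix ι ι ℤ}
    (hP : A.charpoly = cyclotomic m ℤ) : (-A).charpoly = cyclotomic n ℤ := by
  have hcard : Fintype.card ι = Nat.totient m := by
    rw [← Matrix.charpoly_natDegree_eq_dim A, hP, natDegree_cyclotomic]
  have hpos : 0 < Fintype.card ι := by rw [hcard]; exact Nat.totient_pos.2 hm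
  haveI : Nonempty ι := Fintype.card_pos_iff.1 hpos
  set F : Matrix ι ι ℤ →+* Matrix ι ι ℚ := (Int.castRingHom ℚ).mapMatrix with hF
  have hB : (F A).charpoly = cyclotomic m ℚ := by
    rw [hF, RingHom.mapMatrix_apply, Matrix.charpoly_map, hP, map_cyclotomic_int]
  have haeval : aeval (-(F A)) (cyclotomic n ℚ) = 0 := by
    have h1 : aeval (F A) (cyclotomic m ℚ) = 0 := by rw [← hB]; exact Matrix.aeval_self_charpoly _
    have h2 : (cyclotomic n ℚ).comp (-X) = cyclotomic m ℚ := by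
      rw [← map_cyclotomic_int n ℚ, ← map_cyclotomic_int m ℚ, ← hcomp, Polynomial.map_comp]
      simp
    rw [← h2, aeval_comp] at h1
    simpa using h1
  have hmin : minpoly ℚ (-(F A)) = cyclotomic n ℚ :=
    (minpoly.eq_of_irreducible_of_monic (cyclotomic.irreducible_rat hn) haeval (cyclotomic.monic n ℚ)).symm
  have hdvd : cyclotomic n ℚ ∣ (-(F A)).charpoly := hmin ▸ Matrix.minpoly_dvd_charpoly _
  have hQ : (-(F A)).charpoly = cyclotomic n ℚ := by
    refine eq_of_monic_of_dvd_of_natDegree_le (cyclotomic.monic _ ℚ) (Matrix.charpoly_monic _) hdvd ?_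
    rw [Matrix.charpoly_natDegree_eq_dim, natDegree_cyclotomic, hcard, htot]
  apply Polynomial.map_injective (Int.castRingHom ℚ) (Int.castRingHom ℚ).injective_int
  rw [map_cyclotomic_int, ← Matrix.charpoly_map, ← hQ, ← map_neg F A, hF, RingHom.mapMatrix_apply]

/-- **`P_A = Φ₂₆ ⟹ P_{−A} = Φ₁₃`** for an integer matrix `A` (of size `12`). [cite: BirkenhakeLange2004, §13.3 Cor. 13.3.4] [cite: Washington1997, Ch. 2] -/
theorem charpoly_neg_eq_cyclotomic_thirteen_of_charpoly_eq_cyclotomic_twentySix {A : Matrix ι ι ℤ}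
    (hP : A.charpoly = cyclotomic 26 ℤ) : (-A).charpoly = cyclotomic 13 ℤ :=
  charpoly_neg_eq_cyclotomic_of_comp_neg_X₅₁ (by norm_num) (by norm_num) cyclotomic_thirteen_comp_neg_X (by decide) hP

end MatrixAlgebra

/-! ### §2 Complex tori with `P_u = Φ₂₆` -/

section Tori

variable {ι : Type} [Fintype ι] [DecidableEq ι] {E : Type} [NormedAddCommGroup E] [NormedSpace ℂ E] {P : (ι → ℝ) ≃L[ℝ] E}

/-- **`Hdg(Xᵏ) = Div(Xᵏ)` FOR ALL `k`, FOR EVERY COMPLEX TORUS WITH AN ENDOMORPHISM OF CHARACTERISTIC POLYNOMIAL `Φ₂₆`** (through `−u`, `P_{−u} = Φ₁₃`).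
[cite: Shimura1998, §8.4 Example (1)] [cite: Gordon1999HodgeAVSurvey, 7.5] [cite: BirkenhakeLange2004, §13.3] -/
theorem divisorClasses_powPeriod_eq_hodgeClasses_of_charpoly_eq_cyclotomic_twentySix {A : Matrix ι ι ℤ} (hA : A ∈ endRingInt P)
    (hP : A.charpoly = cyclotomic 26 ℤ) (k p : ℕ) :
    divisorClasses (powPeriod P k) p = hodgeClasses (powPeriod P k) p :=
  divisorClasses_powPeriod_eq_hodgeClasses_of_charpoly_eq_cyclotomic_thirteen ((endRingInt P).neg_mem hA)
    (charpoly_neg_eq_cyclotomic_thirteen_of_charpoly_eq_cyclotomic_twentySix hP) k p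

end Tori

/-! ### §3 Abelian varieties with complex multiplication by `ℚ(ζ₂₆) = ℚ(ζ₁₃)` -/

section Varieties

variable {K : Type} [Field K] [NumberField K]
  {A : AbelianVariety ℂ} {ι : 𝓞 K →+* End A} {θ : K →+* Module.End ℂ (complexBetti A.X 1)}

/-- `ℚ(ζ₂₆) = ℚ(ζ₁₃)`. [cite: Washington1997, Ch. 2] [folklore] -/
theorem isCyclotomicExtension_thirteen_of_twentySix (hK : IsCyclotomicExtension {26} ℚ K) : IsCyclotomicExtension {13} ℚ K := by
  haveI : IsCyclotomicExtension {2 * 13} ℚ K := hK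
  exact isCyclotomicExtension_of_two_mul_of_odd (K := K) (by decide)

/-- **THE HODGE CONJECTURE FOR EVERY POWER OF EVERY ABELIAN VARIETY WITH COMPLEX MULTIPLICATION BY `ℚ(ζ₂₆)`** (any CM type).
[cite: Shimura1998, §8.4 Example (1)] [cite: Gordon1999HodgeAVSurvey, Thm. 6.4 and §9.3] -/
theorem hodgeConjectureFor_pow_twentySix (hK : IsCyclotomicExtension {26} ℚ K) (Φ : CMType K) (hA : IsCMTypeRealisation Φ A ι θ) (n : ℕ) :
    HodgeConjectureFor (⨁ fun _ : Fin n => A).dim (⨁ fun _ : Fin n => A).X :=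
  hodgeConjectureFor_pow_thirteen (isCyclotomicExtension_thirteen_of_twentySix hK) Φ hA n

/-- **NONDEGENERATE ⟺ PRIMITIVE for the CM types of `ℚ(ζ₂₆)`.** [cite: Shimura1998, §8.4 Example (1)] -/
theorem isNondegenerate_iff_isPrimitive_twentySix (hK : IsCyclotomicExtension {26} ℚ K) (Φ : CMType K) (φ₀ : K →+* ℂ) :
    IsNondegenerate Φ ↔ IsPrimitive (ℂ ≃+* ℂ) Φ.1 φ₀ :=
  isNondegenerate_iff_isPrimitive_thirteen (isCyclotomicExtension_thirteen_of_twentySix hK) Φ φ₀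

end Varieties

end ComplexTorus

end Literature.Geometry.Kaehler

end
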